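import Summits.CriticalPhenomena.PercolationContinuityZ3.Theorems.FK.PressureUniquenessCriterion
import Summits.CriticalPhenomena.PercolationContinuityZ3.Theorems.FK.PressureQDerivatives
import HarnessLib

/-!
# FK-continuity cell, FO-10a: the pressure has its `p`-partial derivative at `(p,q)` iff it has its `q`-partial derivative
# there — both iff `φ⁰_{p,q} = φ¹_{p,q}` (Grimmett 2006, Thm. (4.60)(c): `π ∈ 𝒟'_κ ⟺ κ ∈ 𝒟″_π`)

Registered R92 (cell INBOX l.6438, 2026-08-24); registry row FO-10a-g338q; label KAQ-C (coordinator fk-4 g195).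
Cell `fk-continuity` (bschramm), row FO-10a; support file for the FK-continuity transplant
(`--supports stmt-CriticalPhenomena-4575`); builds on p205010 (kernel theorem, internal audit signed;
external expert review pending). Pure proofs; no definitions, no named facts, no sorries; `d ≥ 1`.

For a two-parameter pressure function `Ψ : ℝ → ℝ → ℝ` — the per-site thermodynamic limit of `log Z^b_{Λ_N}(x,y)` on a
neighbourhood of `(p,q)` for both boundary conditions (Thm. (4.58), `PressureThermodynamicLimit.lean`; the free ones suffice,
`tendsto_log_rcPartitionFunction_box_div_of_free`) — the `p`-section `Ψ(·,q)` is differentiable at `p` iff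
`φ⁰_{p,q} = φ¹_{p,q}` (Thm. (4.63), `differentiableAt_pressure_iff_rcLimit_eq'`) iff the `q`-section `Ψ(p,·)` is
differentiable at `q` (Lemma (4.79), `differentiableAt_pressure_q_iff`).

* HEADLINE `differentiableAt_pressure_p_iff_differentiableAt_pressure_q` — Thm. (4.60)(c).

## References
* G. Grimmett, *The Random-Cluster Model*, Springer 2006 (`book:grimmett2006-random-cluster-model`): §4.5,
  Thm. (4.60)(c) and its proof via Thm. (4.63) and Lemma (4.79) [PDF pp. 88, 93]. [Grimmett2006]
-/

noncomputable section

open Finset Filter Topology MeasureTheory Set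

namespace Summit.CriticalPhenomena.PercolationContinuityZ3.Theorems.FK

open Literature.Probability.Percolation Literature.Probability.LatticeModels

variable {d : ℕ} {p q : ℝ}

/-- **Grimmett 2006, Thm. (4.60)(c): `π ∈ 𝒟'_κ ⟺ κ ∈ 𝒟″_π`** — for the two-parameter pressure `Ψ` (per-site limit of the
free box pressures on `(0,1) × (a neighbourhood of q)`), the `p`-section is differentiable at `p` iff the `q`-section is
differentiable at `q`; both iff `φ⁰_{p,q} = φ¹_{p,q}` (`d ≥ 1`, `0 < p < 1`, `q > 1`).
[cite: Grimmett2006, Thm. (4.60)(c), Thm. (4.63), Lemma (4.79)] -/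
theorem differentiableAt_pressure_p_iff_differentiableAt_pressure_q (hd : 0 < d) (hp : p ∈ Set.Ioo (0 : ℝ) 1)
    (hq : 1 < q) {Ψ : ℝ → ℝ → ℝ}
    (hΨp : ∀ x ∈ Set.Ioo (0 : ℝ) 1, Tendsto (fun N : ℕ =>
      Real.log (rcPartitionFunction (finsetGraph (zdGraph d) (box d N)) x q (boxBC d false N)) / #(box d N)) atTop (𝓝 (Ψ x q)))
    (hΨq : ∀ᶠ y in 𝓝 q, Tendsto (fun N : ℕ =>
      Real.log (rcPartitionFunction (finsetGraph (zdGraph d) (box d N)) p y (boxBC d false N)) / #(box d N)) atTop (𝓝 (Ψ p y))) :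
    DifferentiableAt ℝ (fun x => Ψ x q) p ↔ DifferentiableAt ℝ (Ψ p) q := by
  have hp' : p ∈ Set.Icc (0 : ℝ) 1 := ⟨hp.1.le, hp.2.le⟩
  -- both boundary conditions converge to `Ψ p y` for `y ≥ 1` near `q` (b.c.-independence of the pressure)
  have hΦ : ∀ b : Bool, ∀ᶠ y in 𝓝 q, Tendsto (fun N : ℕ =>
      Real.log (rcPartitionFunction (finsetGraph (zdGraph d) (box d N)) p y (boxBC d b N)) / #(box d N)) atTop
        (𝓝 (Ψ p y)) := by
    intro b
    filter_upwards [hΨq, eventually_ge_nhds hq] with y hy (hy1 : 1 ≤ y)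
    exact tendsto_log_rcPartitionFunction_box_div_of_free (Φ := fun _ => Ψ p y) hp' hy1 hy b
  rw [differentiableAt_pressure_iff_rcLimit_eq' hd hp hq.le hΨp, differentiableAt_pressure_q_iff hd hp hq hΦ]

end Summit.CriticalPhenomena.PercolationContinuityZ3.Theorems.FK

end
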